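import Summits.HodgeConjecture.HodgeConjecture.Theorems.F0P3cStCharTSHCDescentSemisimpleAlg   -- ★ p852015 (this seat) file A: brings ★ (A′) `isCompl_ker_range_…`, ★ (Q8) `skew_conj_of_skew`, `skew_iff_tau_eq_neg`
import Literature.Analysis.Calculus.UltrametricNewtonChart                                    -- ★ p851977 (F0P2-p01) D1: `exists_depth_linearNewton_of_hasStrictFDerivAt`
import Literature.Analysis.Matrix.UltrametricElementwiseNormCalculus                          -- ★ p852047 (this seat) brick (U): `hasStrictFDerivAt_cayleyConj_add_elementwise`, `norm_mul_le_of_isUltrametricDist`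
import Literature.LinearAlgebra.Matrix.UnitaryFormAdjointCayley                               -- ★ `cayley_mem_unitaryGroupOfForm`, `isUnit_cayley(_iff)`
import Mathlib.Analysis.Normed.Module.FiniteDimension
import Mathlib.Topology.Algebra.Module.FiniteDimension
import HarnessLib

/-!
# F0 · P3c · line LH6 «StCharTS» — ROAD «HC-D», brick (D5ii) «SEMISIMPLE DESCENT AT TYPE (a,a,b)», file C₁ (SLICE MAP, `K`-LEVEL): the linear part
# `e_K (Y, Z) = 2(S₀Y − YS₀) + Z : 𝔪_K × 𝔠_K ≃L[K] M_n(K)`, the strict derivative of `Ψ(Y, Z) = c(Y)(S₀ + Z)c(Y)⁻¹` at `0`, its NEWTON DATA, and the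
# algebra of the descent (`Ψ − S₀ ∈ 𝔲`, conjugation invariance of `charpoly`, closedness ∕ properness of the carriers)

Cell `pub/hodgecm-mathlib`, crux H413 = `stmt-HodgeConjecture-24833` (lane `--supports … --as helper`), route HCCMUnconditional; seat F0P3a-p05 (g23), brick (D4e)+(D5ii)
of F0P2-p01 (g23)'s road «HC-D» (census `F0/P2/p01/g23/CENSUS-HCD.v1.F0P2p01g23.md` §1 (ii); dealt 2026-09-02T16:11:14Z; WORDS #3 16:21:56Z: calculus over `K`, descent by Newton data).
THEOREMS ONLY (no definition ∕ instance ∕ notation ∕ named fact ∕ `sorry`); imports ★ file A + ★ D1 + ★ (U) + ★ `UnitaryFormAdjointCayley` + Mathlib.  File C₂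
`F0P3cStCharTSHCDescentSemisimpleSlice` runs ★ FILE 2′ `depth_chart_of_newtonData` on these data.
HONEST LABEL: HC_CM is proved only modulo the 7 printed citations (2 remaining: hLiu418 = `stmt-HodgeConjecture-24832`, h413 = `stmt-HodgeConjecture-24833`)
until rung 0 closes; count-neutral analysis for the named input (HC-D) «`|D_G|^{−1∕2} ∈ L¹_loc(G)`» [HarishChandra1970, Part VII §1 Thm. 15] of the (S-𝔇) organ; closes no organ.

THE MATHEMATICS ([HarishChandra1970, Part VI Lemma 22]; [Schikhof1984, §27]; [Borel1991, III.9.1]).  `K` complete ultrametric nontrivially normed; `M_n(K)` with the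
ELEMENTWISE sup norm (ultrametric — `isUltrametricDist_matrix`; submultiplicative — ★ (U)); `ad S₀ = L_{S₀} − R_{S₀}`, `𝔪_K = range`, `𝔠_K = ker`.
* §1 `exists_sliceLinearEquivK` — **`e_K : 𝔪_K × 𝔠_K ≃L[K] M_n(K)`, `e_K (Y, Z) = 2(S₀Y − YS₀) + Z`** for `S₀` annihilated by a separable polynomial (★ (A′) + finite dimension);
  `hasStrictFDerivAt_slice` — **`HasStrictFDerivAt Ψ e_K 0`** (★ (U) composed with the subspace inclusions); `exists_newtonData_K` — the Newton data of ★ D1;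
  `isUltrametricDist_matrix ∕ _submodule ∕ _prod` (instance plumbing as theorems).
* §2 `slice_sub_mem` — `Ψ(Y, Z) − S₀` is skew for skew `S₀, Y, Z` (total, junk-aware: `c(Y) ∈ U(σ, J)` when `1 ± Y` are units, else `c(Y)` or `c(Y)⁻¹` is `0`);
  `charpoly_slice_eq` — `charpoly (Ψ(Y, Z)) = charpoly (S₀ + Z)` for `‖Y‖ < 1` (Neumann series under ★ (U)); `properSpace_subtype_of_isClosed`, `isClosed_skew`.

## References
* [HarishChandra1970] Harish-Chandra (notes by G. van Dijk), *Harmonic Analysis on Reductive p-adic Groups*, LNM 162 (1970), Part VI Lemma 22; Part VII §1 Thm. 15.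
* [Schikhof1984] W. H. Schikhof, *Ultrametric Calculus*, Cambridge (1984), §27.
* [Borel1991] A. Borel, *Linear Algebraic Groups*, 2nd ed. (1991), I.4 (4.2, 4.4), III.9.1.
* [Rogawski1990] J. D. Rogawski, *Automorphic Representations of Unitary Groups in Three Variables*, Ann. of Math. Stud. 123 (1990), §1.9 p. 8; §8.2 Prop. 8.2.1 p. 112.
* [Weyl1939] H. Weyl, *The Classical Groups* (1939), Ch. II §10.
* [PlatonovRapinchuk1994] V. Platonov, A. Rapinchuk, *Algebraic Groups and Number Theory* (1994), §3.3.
-/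

set_option autoImplicit false
-- the mandated namespace has the single-problem summit's repeated segment (`HodgeConjecture.HodgeConjecture`)
set_option linter.dupNamespace false

noncomputable section

open MeasureTheory Filter Metric Set Polynomial
open scoped Matrix Matrix.Norms.Elementwise Topology ENNReal Pointwise
open Literature.Analysis.Calculus Literature.Analysis.Matrix Literature.LinearAlgebra.Matrix Literature.NumberTheory.Automorphic
open Summit.HodgeConjecture.HodgeConjecture.Cruxes.H413.F0P3cStCharTSHCDescentSemisimpleAlg
open Summit.HodgeConjecture.HodgeConjecture.Cruxes.H413.F0P3cStCharTSCartanDecompositionSkew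

namespace Summit.HodgeConjecture.HodgeConjecture.Cruxes.H413.F0P3cStCharTSHCDescentSemisimpleSliceK

/-! ## §1 The `K`-level: linear part `e_K` and the strict derivative of the slice map; Newton data -/

section KLevel

variable {K : Type*} [NontriviallyNormedField K] [IsUltrametricDist K] [CompleteSpace K] {n : Type*} [Fintype n] [DecidableEq n]

/-- **The `K`-linear part `e_K : 𝔪_K × 𝔠_K ≃L[K] M_n(K)`, `e_K (Y, Z) = 2(S₀Y − YS₀) + Z`** (`S₀` annihilated by a separable polynomial, `K` perfect of characteristic `0`):
`M_n(K) = 𝔠_K ⊕ 𝔪_K` (★ (A′)) and `ad S₀` is injective on `𝔪_K`, hence an automorphism of it (finite dimension); continuity is automatic. [cite: Borel1991, I.4 (4.2, 4.4); III.9.1] -/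
theorem exists_sliceLinearEquivK [PerfectField K] [CharZero K] {S₀ : Matrix n n K} {p : K[X]} (hp : p.Separable) (hpS : aeval S₀ p = 0) :
    ∃ eK : (↥(LinearMap.range (LinearMap.mulLeft K S₀ - LinearMap.mulRight K S₀ : Module.End K (Matrix n n K))) ×
              ↥(LinearMap.ker (LinearMap.mulLeft K S₀ - LinearMap.mulRight K S₀ : Module.End K (Matrix n n K)))) ≃L[K] Matrix n n K,
      ∀ q, eK q = (2 : K) • (S₀ * (q.1 : Matrix n n K) - (q.1 : Matrix n n K) * S₀) + (q.2 : Matrix n n K) := by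
  set ad : Module.End K (Matrix n n K) := LinearMap.mulLeft K S₀ - LinearMap.mulRight K S₀ with had
  have hK := isCompl_ker_range_mulLeft_sub_mulRight_of_separable_aeval_eq_zero S₀ hp hpS
  -- `ad` restricted to its range, as an injective endomorphism of `𝔪_K`
  have hmaps : ∀ Y ∈ LinearMap.range ad, ad Y ∈ LinearMap.range ad := fun Y _ => ⟨Y, rfl⟩
  let adR : ↥(LinearMap.range ad) →ₗ[K] ↥(LinearMap.range ad) := ad.restrict hmaps
  have hinj : Function.Injective adR := by
    rw [injective_iff_map_eq_zero]
    intro Y hY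
    have h0 : ad (Y : Matrix n n K) = 0 := by
      have := congrArg Subtype.val hY
      simpa [adR, LinearMap.restrict_apply] using this
    have hd := hK.disjoint
    rw [Submodule.disjoint_def] at hd
    exact Subtype.ext (hd _ (LinearMap.mem_ker.2 h0) Y.2)
  have hinj2 : Function.Injective ((2 : K) • adR) := by
    intro Y Y' h
    apply hinj
    have h' : (2 : K) • adR Y = (2 : K) • adR Y' := by simpa [LinearMap.smul_apply] using h
    exact smul_right_injective _ (two_ne_zero : (2 : K) ≠ 0) h'
  let adE : ↥(LinearMap.range ad) ≃ₗ[K] ↥(LinearMap.range ad) := LinearEquiv.ofInjectiveEndo ((2 : K) • adR) hinj2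
  -- the candidate: `(Y, Z) ↦ 2 • ad Y + Z`
  let f : (↥(LinearMap.range ad) × ↥(LinearMap.ker ad)) ≃ₗ[K] Matrix n n K :=
    (LinearEquiv.prodCongr adE (LinearEquiv.refl K _)).trans (Submodule.prodEquivOfIsCompl _ _ hK.symm)
  refine ⟨f.toContinuousLinearEquiv, fun q => ?_⟩
  change f q = _
  have h1 : ((adE q.1 : ↥(LinearMap.range ad)) : Matrix n n K) = (2 : K) • (S₀ * (q.1 : Matrix n n K) - (q.1 : Matrix n n K) * S₀) := by
    have : (adE q.1 : ↥(LinearMap.range ad)) = ((2 : K) • adR) q.1 := by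
      rw [← LinearEquiv.coe_ofInjectiveEndo _ hinj2]
    rw [this, LinearMap.smul_apply, Submodule.coe_smul]
    simp [adR, LinearMap.restrict_apply, had]
  simp only [f, LinearEquiv.trans_apply, LinearEquiv.prodCongr_apply, LinearEquiv.refl_apply, Submodule.coe_prodEquivOfIsCompl', h1]

omit [CompleteSpace K] [DecidableEq n] in
/-- The product of two ultrametric (sub)spaces is ultrametric for the sup distance. [folklore] -/
theorem isUltrametricDist_prod {A B : Type*} [PseudoMetricSpace A] [PseudoMetricSpace B] [IsUltrametricDist A] [IsUltrametricDist B] :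
    IsUltrametricDist (A × B) := by
  refine ⟨fun x y z => ?_⟩
  rw [Prod.dist_eq, Prod.dist_eq, Prod.dist_eq]
  refine max_le ?_ ?_
  · exact (IsUltrametricDist.dist_triangle_max x.1 y.1 z.1).trans (max_le_max (le_max_left _ _) (le_max_left _ _))
  · exact (IsUltrametricDist.dist_triangle_max x.2 y.2 z.2).trans (max_le_max (le_max_right _ _) (le_max_right _ _))

omit [CompleteSpace K] [DecidableEq n] in
/-- `M_n(K)` with the elementwise sup norm is ultrametric when `K` is (it is a `Pi` type; the instance does not see through the `Matrix` synonym). [folklore] -/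
theorem isUltrametricDist_matrix {m : Type*} [Fintype m] : IsUltrametricDist (Matrix m n K) :=
  inferInstanceAs (IsUltrametricDist (m → n → K))

omit [CompleteSpace K] [DecidableEq n] [IsUltrametricDist K] [NontriviallyNormedField K] [Fintype n] in
/-- A submodule of an ultrametric normed group is ultrametric (the induced distance is the ambient one). [folklore] -/
theorem isUltrametricDist_submodule {R : Type*} [Ring R] {E : Type*} [NormedAddCommGroup E] [Module R E] [IsUltrametricDist E] (p : Submodule R E) :
    IsUltrametricDist ↥p := by
  refine ⟨fun x y z => ?_⟩
  have h := IsUltrametricDist.dist_triangle_max (x : E) (y : E) (z : E)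
  simpa only [dist_eq_norm, ← Submodule.coe_sub, Submodule.coe_norm] using h

/-- **The slice map `Ψ(Y, Z) = c(Y)(S₀ + Z)c(Y)⁻¹` on `𝔪_K × 𝔠_K` has strict derivative `e_K` at `0`** (★ (U) on `M_n(K) × M_n(K)`, composed with the subspace inclusions).
[cite: HarishChandra1970, Part VI Lemma 22] [cite: Schikhof1984, §27] -/
theorem hasStrictFDerivAt_slice (S₀ : Matrix n n K)
    (eK : (↥(LinearMap.range (LinearMap.mulLeft K S₀ - LinearMap.mulRight K S₀ : Module.End K (Matrix n n K))) ×
              ↥(LinearMap.ker (LinearMap.mulLeft K S₀ - LinearMap.mulRight K S₀ : Module.End K (Matrix n n K)))) ≃L[K] Matrix n n K)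
    (heK : ∀ q, eK q = (2 : K) • (S₀ * (q.1 : Matrix n n K) - (q.1 : Matrix n n K) * S₀) + (q.2 : Matrix n n K)) :
    HasStrictFDerivAt
      (fun q : ↥(LinearMap.range (LinearMap.mulLeft K S₀ - LinearMap.mulRight K S₀ : Module.End K (Matrix n n K))) ×
          ↥(LinearMap.ker (LinearMap.mulLeft K S₀ - LinearMap.mulRight K S₀ : Module.End K (Matrix n n K))) =>
        cayley (q.1 : Matrix n n K) * (S₀ + (q.2 : Matrix n n K)) * Ring.inverse (cayley (q.1 : Matrix n n K)))
      (eK : _ →L[K] Matrix n n K) 0 := by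
  obtain ⟨D, hD, hΨ⟩ := hasStrictFDerivAt_cayleyConj_add_elementwise (n := n) S₀
  -- the inclusion `ι : 𝔪_K × 𝔠_K →L[K] M_n(K) × M_n(K)`
  have hι : HasStrictFDerivAt
      (fun q : ↥(LinearMap.range (LinearMap.mulLeft K S₀ - LinearMap.mulRight K S₀ : Module.End K (Matrix n n K))) ×
          ↥(LinearMap.ker (LinearMap.mulLeft K S₀ - LinearMap.mulRight K S₀ : Module.End K (Matrix n n K))) => ((q.1 : Matrix n n K), (q.2 : Matrix n n K)))
      (((LinearMap.range (LinearMap.mulLeft K S₀ - LinearMap.mulRight K S₀ : Module.End K (Matrix n n K))).subtypeL).prodMap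
        ((LinearMap.ker (LinearMap.mulLeft K S₀ - LinearMap.mulRight K S₀ : Module.End K (Matrix n n K))).subtypeL)) 0 :=
    (((LinearMap.range (LinearMap.mulLeft K S₀ - LinearMap.mulRight K S₀ : Module.End K (Matrix n n K))).subtypeL).prodMap
        ((LinearMap.ker (LinearMap.mulLeft K S₀ - LinearMap.mulRight K S₀ : Module.End K (Matrix n n K))).subtypeL)).hasStrictFDerivAt
  have hcomp := HasStrictFDerivAt.comp
    (f := fun q : ↥(LinearMap.range (LinearMap.mulLeft K S₀ - LinearMap.mulRight K S₀ : Module.End K (Matrix n n K))) ×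
          ↥(LinearMap.ker (LinearMap.mulLeft K S₀ - LinearMap.mulRight K S₀ : Module.End K (Matrix n n K))) => ((q.1 : Matrix n n K), (q.2 : Matrix n n K)))
    0 hΨ hι
  refine hcomp.congr_fderiv (ContinuousLinearMap.ext fun q => ?_)
  change D ((q.1 : Matrix n n K), (q.2 : Matrix n n K)) = eK q
  rw [hD, heK]

/-- **NEWTON DATA for the slice map on `𝔪_K × 𝔠_K`** (★ D1 from the strict derivative; base point `0`; any box size `r > 0`, ratio `γ ∈ (0,1)`).
[cite: Schikhof1984, §27 Lemma 27.4–Thm. 27.5] -/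
theorem exists_newtonData_K (S₀ : Matrix n n K)
    (eK : (↥(LinearMap.range (LinearMap.mulLeft K S₀ - LinearMap.mulRight K S₀ : Module.End K (Matrix n n K))) ×
              ↥(LinearMap.ker (LinearMap.mulLeft K S₀ - LinearMap.mulRight K S₀ : Module.End K (Matrix n n K)))) ≃L[K] Matrix n n K)
    (heK : ∀ q, eK q = (2 : K) • (S₀ * (q.1 : Matrix n n K) - (q.1 : Matrix n n K) * S₀) + (q.2 : Matrix n n K))
    {r γ : ℝ} (hr : 0 < r) (hγ0 : 0 < γ) (hγ1 : γ < 1) :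
    ∃ k₀ : ℕ, ∀ k, k₀ ≤ k → ∀ j, k ≤ j →
      ∀ x ∈ closedBall (0 : ↥(LinearMap.range (LinearMap.mulLeft K S₀ - LinearMap.mulRight K S₀ : Module.End K (Matrix n n K))) ×
              ↥(LinearMap.ker (LinearMap.mulLeft K S₀ - LinearMap.mulRight K S₀ : Module.End K (Matrix n n K)))) (r * γ ^ k),
      ∀ y ∈ closedBall (0 : ↥(LinearMap.range (LinearMap.mulLeft K S₀ - LinearMap.mulRight K S₀ : Module.End K (Matrix n n K))) ×
              ↥(LinearMap.ker (LinearMap.mulLeft K S₀ - LinearMap.mulRight K S₀ : Module.End K (Matrix n n K)))) (r * γ ^ j),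
        (fun q : ↥(LinearMap.range (LinearMap.mulLeft K S₀ - LinearMap.mulRight K S₀ : Module.End K (Matrix n n K))) ×
            ↥(LinearMap.ker (LinearMap.mulLeft K S₀ - LinearMap.mulRight K S₀ : Module.End K (Matrix n n K))) =>
          cayley (q.1 : Matrix n n K) * (S₀ + (q.2 : Matrix n n K)) * Ring.inverse (cayley (q.1 : Matrix n n K))) (0 + (x + y)) -
          (fun q : ↥(LinearMap.range (LinearMap.mulLeft K S₀ - LinearMap.mulRight K S₀ : Module.End K (Matrix n n K))) ×
            ↥(LinearMap.ker (LinearMap.mulLeft K S₀ - LinearMap.mulRight K S₀ : Module.End K (Matrix n n K))) =>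
          cayley (q.1 : Matrix n n K) * (S₀ + (q.2 : Matrix n n K)) * Ring.inverse (cayley (q.1 : Matrix n n K))) (0 + x) - eK y ∈
          (eK : _ → Matrix n n K) '' closedBall 0 (r * γ ^ (j + 1)) := by
  haveI : IsUltrametricDist (Matrix n n K) := isUltrametricDist_matrix
  haveI := isUltrametricDist_submodule (LinearMap.range (LinearMap.mulLeft K S₀ - LinearMap.mulRight K S₀ : Module.End K (Matrix n n K)))
  haveI := isUltrametricDist_submodule (LinearMap.ker (LinearMap.mulLeft K S₀ - LinearMap.mulRight K S₀ : Module.End K (Matrix n n K)))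
  haveI : IsUltrametricDist (↥(LinearMap.range (LinearMap.mulLeft K S₀ - LinearMap.mulRight K S₀ : Module.End K (Matrix n n K))) ×
      ↥(LinearMap.ker (LinearMap.mulLeft K S₀ - LinearMap.mulRight K S₀ : Module.End K (Matrix n n K)))) := isUltrametricDist_prod
  exact exists_depth_linearNewton_of_hasStrictFDerivAt (x₀ := 0) eK (hasStrictFDerivAt_slice S₀ eK heK) hr hγ0 hγ1

end KLevel


/-! ## §2 Descent to the `F`-Lie algebra: `Ψ − S₀ ∈ 𝔲`, conjugation invariance of `charpoly`, closed subsets of proper spaces -/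

section Descent

variable {K : Type*} [NontriviallyNormedField K] [IsUltrametricDist K] [CompleteSpace K] {n : Type*} [Fintype n] [DecidableEq n]
  (σ : K →+* K) (J : Matrix n n K) (hJ : IsUnit J.det)

omit [NontriviallyNormedField K] [IsUltrametricDist K] [CompleteSpace K] in
/-- **`Ψ(Y, Z) − S₀ ∈ 𝔲` for skew `Y, Z, S₀`** (total version with `Ring.inverse`): if `1 ± Y` are units then `c(Y) ∈ U(σ, J)` (★ `cayley_mem_unitaryGroupOfForm`) and conjugation by a
unitary preserves skewness (★ `skew_conj_of_skew`); otherwise `c(Y)` or `c(Y)⁻¹` is the junk value `0` and `Ψ(Y, Z) − S₀ = −S₀`. [cite: Weyl1939, Ch. II §10] [cite: Rogawski1990, §1.9 p. 8] -/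
theorem slice_sub_mem {K : Type*} [Field K] (σ : K →+* K) (J : Matrix n n K) (hJ : IsUnit J.det) {S₀ Y Z : Matrix n n K}
    (hS : (S₀.map σ)ᵀ * J + J * S₀ = 0) (hY : (Y.map σ)ᵀ * J + J * Y = 0) (hZ : (Z.map σ)ᵀ * J + J * Z = 0) :
    ((cayley Y * (S₀ + Z) * Ring.inverse (cayley Y) - S₀).map σ)ᵀ * J + J * (cayley Y * (S₀ + Z) * Ring.inverse (cayley Y) - S₀) = 0 := by
  have hSZ : ((S₀ + Z).map σ)ᵀ * J + J * (S₀ + Z) = 0 := by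
    rw [Matrix.map_add _ (map_add σ), Matrix.transpose_add, Matrix.add_mul, Matrix.mul_add]
    calc (S₀.map σ)ᵀ * J + (Z.map σ)ᵀ * J + (J * S₀ + J * Z) = ((S₀.map σ)ᵀ * J + J * S₀) + ((Z.map σ)ᵀ * J + J * Z) := by abel
      _ = 0 := by rw [hS, hZ, add_zero]
  -- subtracting the skew `S₀` preserves skewness
  have hsub : ∀ W : Matrix n n K, (W.map σ)ᵀ * J + J * W = 0 →
      ((W - S₀).map σ)ᵀ * J + J * (W - S₀) = 0 := by
    intro W hW
    rw [Matrix.map_sub _ (map_sub σ), Matrix.transpose_sub, Matrix.sub_mul, Matrix.mul_sub]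
    calc (W.map σ)ᵀ * J - (S₀.map σ)ᵀ * J + (J * W - J * S₀) = ((W.map σ)ᵀ * J + J * W) - ((S₀.map σ)ᵀ * J + J * S₀) := by abel
      _ = 0 := by rw [hW, hS, sub_zero]
  have hneg : ((0 : Matrix n n K).map σ)ᵀ * J + J * 0 = 0 := by
    rw [Matrix.map_zero σ (map_zero σ), Matrix.transpose_zero, Matrix.zero_mul, Matrix.mul_zero, add_zero]
  by_cases hp : IsUnit (1 + Y)
  · by_cases hm : IsUnit (1 - Y)
    · obtain ⟨g, hg, hgc⟩ := cayley_mem_unitaryGroupOfForm σ hJ ((skew_iff_tau_eq_neg σ J hJ Y).1 hY) hp hm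
      have hinv : Ring.inverse (cayley Y) = ((g⁻¹ : GL n K) : Matrix n n K) := by
        rw [← hgc]; exact Ring.inverse_unit g
      rw [hinv, ← hgc]
      exact hsub _ (skew_conj_of_skew σ J g (mem_unitaryGroupOfForm_iff.1 hg) hSZ)
    · have h0 : Ring.inverse (cayley Y) = 0 := Ring.inverse_non_unit _ (fun h => hm ((isUnit_cayley_iff hp).1 h))
      rw [h0, Matrix.mul_zero]
      exact hsub 0 hneg
  · have h0 : cayley Y = 0 := by rw [cayley_def, Ring.inverse_non_unit _ hp, mul_zero]
    rw [h0, Matrix.zero_mul, Matrix.zero_mul]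
    exact hsub 0 hneg

omit [IsUltrametricDist K] [CompleteSpace K] in
/-- **Conjugation invariance on the slice:** for `‖Y‖ < 1` (elementwise norm, `K` complete ultrametric, so `1 ± Y` are units by the Neumann series under ★ (U)),
`charpoly (c(Y)(S₀ + Z)c(Y)⁻¹) = charpoly (S₀ + Z)`; in particular every function of `charpoly` (the road's `η = disc ∘ charpoly`) reads `S₀ + Z` on the slice.
[cite: HarishChandra1970, Part VI Lemma 22] -/
theorem charpoly_slice_eq [IsUltrametricDist K] [CompleteSpace K] {S₀ Y Z : Matrix n n K} (hY : ‖Y‖ < 1) :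
    (cayley Y * (S₀ + Z) * Ring.inverse (cayley Y)).charpoly = (S₀ + Z).charpoly := by
  letI i1 : NormedRing (Matrix n n K) :=
    { Matrix.normedAddCommGroup, (inferInstance : Ring (Matrix n n K)) with norm_mul_le := norm_mul_le_of_isUltrametricDist }
  haveI i2 : CompleteSpace (Matrix n n K) := inferInstanceAs (CompleteSpace (n → n → K))
  haveI : HasSummableGeomSeries (Matrix n n K) := @instHasSummableGeomSeriesOfCompleteSpace _ i1 i2
  have hp : IsUnit (1 + Y) := by
    have h := isUnit_one_sub_of_norm_lt_one (x := -Y) (by rwa [norm_neg])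
    rwa [sub_neg_eq_add] at h
  have hm : IsUnit (1 - Y) := isUnit_one_sub_of_norm_lt_one hY
  obtain ⟨u, hu⟩ := isUnit_cayley hp hm
  rw [← hu, Ring.inverse_unit, Matrix.coe_units_inv]
  exact Matrix.charpoly_units_conj u (S₀ + Z)

end Descent

/-! ## §2b Closedness and properness of the carriers -/

section Carriers

variable {K : Type*} [NontriviallyNormedField K] [IsUltrametricDist K] [CompleteSpace K] {n : Type*} [Fintype n] [DecidableEq n]
  (σ : K →+* K) (J : Matrix n n K)

omit [IsUltrametricDist K] [CompleteSpace K] [DecidableEq n] in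
/-- A closed subset of `M_n(K)` (elementwise norm, `K` proper) is a proper metric space in the induced metric. [folklore] -/
theorem properSpace_subtype_of_isClosed [ProperSpace K] {s : Set (Matrix n n K)} (hs : IsClosed s) : ProperSpace ↥s := by
  haveI : ProperSpace (Matrix n n K) := inferInstanceAs (ProperSpace (n → n → K))
  refine ⟨fun x r => ?_⟩
  have h := hs.isClosedEmbedding_subtypeVal.isCompact_preimage (isCompact_closedBall (x : Matrix n n K) r)
  exact h

omit [IsUltrametricDist K] [CompleteSpace K] [DecidableEq n] in
/-- The skew set `{X ∣ ᵗ(σX)J + JX = 0}` is closed when `σ` is continuous. [cite: PlatonovRapinchuk1994, §3.3] -/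
theorem isClosed_skew (hσ : Continuous σ) : IsClosed {X : Matrix n n K | (X.map σ)ᵀ * J + J * X = 0} :=
  isClosed_eq (((continuous_id.matrix_map hσ).matrix_transpose.matrix_mul continuous_const).add (continuous_const.matrix_mul continuous_id))
    continuous_const

end Carriers

end Summit.HodgeConjecture.HodgeConjecture.Cruxes.H413.F0P3cStCharTSHCDescentSemisimpleSliceK

end
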